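import Mathlib.CategoryTheory.Equivalence
import Literature.AnabelianGeometry.EtaleTheta.TemperedFrobenioidToyDilation
import Literature.AnabelianGeometry.EtaleTheta.TemperedFrobenioidCor38Sub
import HarnessLib

/-!
# The DEGREE↔DILATION SWAP: a self-equivalence of the category of a typed tempered Frobenioid that exchanges
# Frobenius degrees with base dilations (toy data over `SingleObj ℕ_{≥1}`, part 2: the functor and the equivalence)

S. Mochizuki, *The geometry of Frobenioids I*, Kyushu J. Math. **62** (2008) [FrdI], Thm. 5.2 (i) p. 100, Def. 1.2 (i)
p. 21, Thm. 3.4 (iii) p. 62 ("`Ψ` preserves Frobenius degrees" — under NON-DILATING `Φ` and bases of FSMFF-type)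
[cite: MochizukiFrdI2008, Thm. 5.2(i) p.100]; S. Mochizuki, *The étale theta function …*, Publ. RIMS **45** (2009) [EtTh],
Cor. 3.8 p. 80–81 [cite: MochizukiEtTh2009, Cor 3.8 p.81].  abc-iut cell, block F, seat abc-iut-f-142 (gen 3); DATA file
(part 2 of 3; part 1 = `TemperedFrobenioidToyDilation.lean`, part 3 = the proof-only
`TemperedFrobenioidCor38SubDilationNegative.lean`).

THE MECHANISM.  In the model category of part 1's `DilSwap.C` every Hom-set is `{(d, n, z)} = ℕ_{≥1} × ℕ_{≥1} × ℚ_{≥0}`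
(Frobenius degree, base exponent, zero divisor; the rational function is determined) with composition
`(d₁, n₁, z₁) ≫ (d₂, n₂, z₂) = (d₁d₂, n₁n₂, z₂/n₁ + d₂·z₁)`: the base exponent CONTRACTS the later divisor exactly as the
Frobenius degree EXPANDS the earlier one.  The map
  `σ : (d, n, z, u) ↦ (n, d, (n/d)·z, (n/d)·u)`
is therefore compatible with composition (cocycle identity `DilSwap.sdiv_comp` of part 1) and identities: collapsing
all objects onto `X₀ = (•, 0)` (all objects are isomorphic, `DilSwap.clsIso`) it is a FUNCTOR `DilSwap.swap : C ⥤ C`, which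
is faithful, full and essentially surjective (`swap_faithful`, `swap_full`, `swap_essSurj`), hence an equivalence of
categories `DilSwap.swapEquiv : C.category ≌ C.category` (Mathlib `Functor.asEquivalence`; `swapEquiv.functor = swap`).
It FIXES the pre-steps `(1, 1, z)` and `O^▷(−)` pointwise but sends the LINEAR base-dilation `λ₂ = (1, 2, 0)` to the
degree-`2` Frobenius `(2, 1, 0)` (`degFr_swap_lam₂`) — the first degree-moving equivalence of a typed tempered
Frobenioid's category recorded in this tree.  What this means for the Cor. 3.8 rows (it is NOT a `Cor38Hyp`: the base
violates the REAL FSMFF clause) is part 3.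
HONEST FRAMING: bookkeeping about the TYPED Def. 3.6 interface at a dilating toy; [FrdI] Thm. 3.4 (iii) as printed
assumes `Φ` non-dilating and `D` of FSMFF-type, both violated here by design; nothing here bears on [IUTchIII] Cor. 3.12;
no side taken; typed ≠ proved.
-/

noncomputable section

namespace Literature.AnabelianGeometry.EtaleTheta

open CategoryTheory Opposite Literature.AlgebraicGeometry.Frobenioids

namespace DilSwap

/-! ## §4 The degree↔dilation SWAP: `(d, n, z, u) ↦ (n, d, (n/d)·z, (n/d)·u)`, collapsed onto `X₀ = (•, 0)` -/

/-- The zero object `X₀ = (•, 0)` of the model category `C` ([FrdI] Thm. 5.2 proof). [cite: MochizukiFrdI2008, Thm. 5.2 p.101] -/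
abbrev X₀ : C.category := ⟨pt, 1⟩

/-- **The swap on arrows**: `φ = (deg d, base n, Div z, u)` goes to the endomorphism `(deg n, base d, (n/d)·z,
the isometric function of (n/d)·z)` of `X₀`. [cite: MochizukiFrdI2008, Thm. 5.2(i) p.100] -/
def swapHom {X Y : C.category} (φ : X ⟶ Y) : X₀ ⟶ X₀ where
  degFr := expo (ModelFrobenioid.baseMap φ)
  base := arrowAt pt pt (ModelFrobenioid.degFr φ)
  div := φOf (op pt) (sdiv (ModelFrobenioid.degFr φ) (expo (ModelFrobenioid.baseMap φ)) (dval (ModelFrobenioid.div φ)))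
  unit := swapUnit (sdiv (ModelFrobenioid.degFr φ) (expo (ModelFrobenioid.baseMap φ)) (dval (ModelFrobenioid.div φ)))
  rel := by
    change (1 : Algebra.GrothendieckGroup _) ^ _ * _ = pullGp C.divisorMonoid _ 1 * Algebra.GrothendieckGroup.of _
    rw [one_pow, one_mul, map_one, one_mul]

/-- Components of `swapHom` (bookkeeping). [cite: MochizukiFrdI2008, Thm. 5.2(i) p.100] -/
@[simp] theorem degFr_swapHom {X Y : C.category} (φ : X ⟶ Y) :
    ModelFrobenioid.degFr (swapHom φ) = expo (ModelFrobenioid.baseMap φ) := rfl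

/-- Components of `swapHom` (bookkeeping). [cite: MochizukiFrdI2008, Thm. 5.2(i) p.100] -/
@[simp] theorem baseMap_swapHom {X Y : C.category} (φ : X ⟶ Y) :
    ModelFrobenioid.baseMap (swapHom φ) = arrowAt pt pt (ModelFrobenioid.degFr φ) := rfl

/-- Components of `swapHom` (bookkeeping). [cite: MochizukiFrdI2008, Thm. 5.2(i) p.100] -/
@[simp] theorem div_swapHom {X Y : C.category} (φ : X ⟶ Y) :
    ModelFrobenioid.div (swapHom φ) =
      φOf (op pt) (sdiv (ModelFrobenioid.degFr φ) (expo (ModelFrobenioid.baseMap φ)) (dval (ModelFrobenioid.div φ))) := rfl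

/-- Components of `swapHom` (bookkeeping). [cite: MochizukiFrdI2008, Thm. 5.2(i) p.100] -/
@[simp] theorem unit_swapHom {X Y : C.category} (φ : X ⟶ Y) :
    ModelFrobenioid.unit (swapHom φ) =
      swapUnit (sdiv (ModelFrobenioid.degFr φ) (expo (ModelFrobenioid.baseMap φ)) (dval (ModelFrobenioid.div φ))) := rfl

/-- The value of the zero divisor of a composite in `C`: `Div(φ ≫ ψ) = Div(ψ)/n_φ + deg(ψ)·Div(φ)`.
[cite: MochizukiFrdI2008, Thm. 5.2(i) p.100] -/
theorem div_comp_val {X Y Z : C.category} (φ : X ⟶ Y) (ψ : Y ⟶ Z) :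
    dval (ModelFrobenioid.div (φ ≫ ψ)) =
      scale (((expo (ModelFrobenioid.baseMap φ) : ℕ) : ℚ≥0))⁻¹ (dval (ModelFrobenioid.div ψ)) *
        dval (ModelFrobenioid.div φ) ^ ((ModelFrobenioid.degFr ψ : ℕ)) := rfl

/-- **The swap is a functor** `C → C` (every object to `X₀`): identities by `sdiv 1 1 = id`, composites by the
cocycle identity `sdiv_comp`. [cite: MochizukiFrdI2008, Thm. 5.2(i) p.100] -/
def swap : C.category ⥤ C.category where
  obj _ := X₀
  map φ := swapHom φ
  map_id X := by
    apply ModelFrobenioid.hom_ext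
    · rfl
    · rfl
    · change φOf (op pt) (sdiv 1 1 (1 : M)) = 1
      rw [sdiv_one_one, φOf_one]
    · change swapUnit (sdiv 1 1 (1 : M)) = 1
      rw [sdiv_one_one, swapUnit_one]
  map_comp {X Y Z} φ ψ := by
    apply ModelFrobenioid.hom_ext
    · rfl
    · rfl
    · apply Subtype.ext
      change sdiv (ModelFrobenioid.degFr ψ * ModelFrobenioid.degFr φ)
          (expo (ModelFrobenioid.baseMap ψ) * expo (ModelFrobenioid.baseMap φ)) (dval (ModelFrobenioid.div (φ ≫ ψ))) =
        scale (((expo (arrowAt pt pt (ModelFrobenioid.degFr φ)) : ℕ) : ℚ≥0))⁻¹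
            (sdiv (ModelFrobenioid.degFr ψ) (expo (ModelFrobenioid.baseMap ψ)) (dval (ModelFrobenioid.div ψ))) *
          sdiv (ModelFrobenioid.degFr φ) (expo (ModelFrobenioid.baseMap φ)) (dval (ModelFrobenioid.div φ)) ^
            ((expo (ModelFrobenioid.baseMap ψ) : ℕ))
      rw [div_comp_val, sdiv_comp, expo_arrowAt]
    · change swapUnit _ = (C.ratFnFunctor.map (arrowAt pt pt (ModelFrobenioid.degFr φ)).op).hom (swapUnit _) *
        swapUnit _ ^ ((expo (ModelFrobenioid.baseMap ψ) : ℕ))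
      rw [ratFnFunctor_map_swapUnit, ← swapUnit_pow, ← swapUnit_mul, div_comp_val, ModelFrobenioid.degFr_comp,
        ModelFrobenioid.baseMap_comp, expo_comp, sdiv_comp]

/-! ## §5 The swap is an EQUIVALENCE of categories (full, faithful, essentially surjective) -/

/-- In `B = B₀^Λ ×_{(Φ^{ℝ-log})^gp} Φ^gp` with `B₀^Λ = (Φ^{ℝ-log})^gp`, `Div = id`, the function component of a
rational function IS the image of its divisor class. [cite: MochizukiEtTh2009, Def 3.6 p.77] -/
theorem ratFn_fst_eq (A : (SingleObj ℕ+)ᵒᵖ) (u : (C.ratFnFunctor.obj A : Type)) :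
    u.1.1 = C.ΦgpToRlog A u.1.2 := u.2

/-- Hence a rational function is determined by its divisor class. [cite: MochizukiEtTh2009, Def 3.6 p.77] -/
theorem ratFn_ext (A : (SingleObj ℕ+)ᵒᵖ) {u v : (C.ratFnFunctor.obj A : Type)} (h : u.1.2 = v.1.2) : u = v :=
  Subtype.ext (Prod.ext (by rw [ratFn_fst_eq, ratFn_fst_eq, h]) h)

/-- The divisor class of `u_φ` is forced by the relation of [FrdI] Thm. 5.2 (i):
`Div_B(u_φ) = Φ(Base φ)(β)⁻¹ · (α^{deg φ} · Div φ)`. [cite: MochizukiFrdI2008, Thm. 5.2(i) p.100] -/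
theorem unit_snd_eq {X Y : C.category} (φ : X ⟶ Y) :
    (ModelFrobenioid.unit φ).1.2 = (pullGp C.divisorMonoid (ModelFrobenioid.baseMap φ) Y.cls)⁻¹ *
      (X.cls ^ ((ModelFrobenioid.degFr φ : ℕ)) * Algebra.GrothendieckGroup.of (ModelFrobenioid.div φ)) := by
  have h := ModelFrobenioid.rel φ
  rw [divB_apply] at h
  rw [h, inv_mul_cancel_left]

/-- `(e/n) ≠ 0` for positive naturals (bookkeeping for the swapped divisor `(e/n)·z`). [cite: MochizukiEtTh2009, Def 3.6 p.77] -/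
theorem div_cast_ne_zero (n e : ℕ+) : ((e : ℕ) : ℚ≥0) / ((n : ℕ) : ℚ≥0) ≠ 0 :=
  div_ne_zero (cast_ne_zero e) (cast_ne_zero n)

/-- **The swap is faithful**: `(deg, Base, Div)` are read off the image (swapped back and rescaled), and `u` is
determined by them. [cite: MochizukiFrdI2008, Thm. 5.2(i) p.100] -/
theorem swap_faithful : swap.Faithful := ⟨fun {X Y} φ ψ h => by
  change swapHom φ = swapHom ψ at h
  have hb : ModelFrobenioid.baseMap φ = ModelFrobenioid.baseMap ψ := congrArg ModelFrobenioid.degFr h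
  have hd : ModelFrobenioid.degFr φ = ModelFrobenioid.degFr ψ :=
    congrArg (fun χ => expo (ModelFrobenioid.baseMap χ)) h
  have hz' : sdiv (ModelFrobenioid.degFr φ) (expo (ModelFrobenioid.baseMap φ)) (dval (ModelFrobenioid.div φ)) =
      sdiv (ModelFrobenioid.degFr ψ) (expo (ModelFrobenioid.baseMap ψ)) (dval (ModelFrobenioid.div ψ)) :=
    congrArg (fun χ => dval (ModelFrobenioid.div χ)) h
  rw [hb, hd] at hz'
  have hz : ModelFrobenioid.div φ = ModelFrobenioid.div ψ :=
    dval_injective _ (scale_injective (div_cast_ne_zero _ _) hz')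
  have hu : ModelFrobenioid.unit φ = ModelFrobenioid.unit ψ :=
    ratFn_ext _ (by rw [unit_snd_eq, unit_snd_eq, hb, hd, hz])
  exact ModelFrobenioid.hom_ext hd hb hz hu⟩

/-- The rational function FORCED on an arrow `(A, α) → (B, β)` with data `(n, f, x)` by the relation of
[FrdI] Thm. 5.2 (i): divisor class `ξ := Φ(f)(β)⁻¹ · α^n · x`, function `ι(ξ)`. [cite: MochizukiFrdI2008, Thm. 5.2(i) p.100] -/
def unitOf (X Y : C.category) (n : ℕ+) (f : X.base ⟶ Y.base) (x : (C.divisorMonoid.obj (op X.base) : Type)) :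
    (C.ratFnFunctor.obj (op X.base) : Type) :=
  (⟨(C.ΦgpToRlog (op X.base)
      ((pullGp C.divisorMonoid f Y.cls)⁻¹ * (X.cls ^ ((n : ℕ)) * Algebra.GrothendieckGroup.of x)),
    (pullGp C.divisorMonoid f Y.cls)⁻¹ * (X.cls ^ ((n : ℕ)) * Algebra.GrothendieckGroup.of x)), rfl⟩ :
    ↥(C.ratFn (op X.base)))

/-- The arrow `(A, α) → (B, β)` of `C` with prescribed `(deg, Base, Div) = (n, f, x)` (it exists for ALL data,
`B` being all of `Φ^gp`). [cite: MochizukiFrdI2008, Thm. 5.2(i) p.100] -/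
def homOf (X Y : C.category) (n : ℕ+) (f : X.base ⟶ Y.base) (x : (C.divisorMonoid.obj (op X.base) : Type)) :
    X ⟶ Y where
  degFr := n
  base := f
  div := x
  unit := unitOf X Y n f x
  rel := by
    rw [divB_apply]
    exact (mul_inv_cancel_left _ _).symm

/-- The swap-preimage of an endomorphism `ψ = (a, b, w, ·)` of `X₀` between arbitrary objects: `(b, a, (b/a)·w, ·)`.
[cite: MochizukiFrdI2008, Thm. 5.2(i) p.100] -/
def swapPre (X Y : C.category) (ψ : X₀ ⟶ X₀) : X ⟶ Y :=
  homOf X Y (expo (ModelFrobenioid.baseMap ψ)) (arrowAt X.base Y.base (ModelFrobenioid.degFr ψ))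
    (φOf (op X.base) (sdiv (ModelFrobenioid.degFr ψ) (expo (ModelFrobenioid.baseMap ψ)) (dval (ModelFrobenioid.div ψ))))

/-- The rational function of an endomorphism of `X₀ = (•, 0)` is the isometric one of its divisor.
[cite: MochizukiFrdI2008, Thm. 5.2(i) p.100] -/
theorem unit_eq_swapUnit (ψ : X₀ ⟶ X₀) : ModelFrobenioid.unit ψ = swapUnit (dval (ModelFrobenioid.div ψ)) := by
  apply ratFn_ext
  rw [unit_snd_eq]
  change (pullGp C.divisorMonoid (ModelFrobenioid.baseMap ψ) 1)⁻¹ *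
      (1 ^ ((ModelFrobenioid.degFr ψ : ℕ)) * Algebra.GrothendieckGroup.of (ModelFrobenioid.div ψ)) =
    Algebra.GrothendieckGroup.of (φOf (op pt) (dval (ModelFrobenioid.div ψ)))
  rw [map_one, inv_one, one_mul, one_pow, one_mul, φOf_dval]

/-- `swap (swapPre ψ) = ψ`. [cite: MochizukiFrdI2008, Thm. 5.2(i) p.100] -/
theorem swap_map_swapPre (X Y : C.category) (ψ : X₀ ⟶ X₀) : swap.map (swapPre X Y ψ) = ψ := by
  apply ModelFrobenioid.hom_ext
  · rfl
  · rfl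
  · change φOf (op pt) (sdiv (expo (ModelFrobenioid.baseMap ψ)) (ModelFrobenioid.degFr ψ)
      (dval (φOf (op pt) (sdiv (ModelFrobenioid.degFr ψ) (expo (ModelFrobenioid.baseMap ψ))
        (dval (ModelFrobenioid.div ψ)))))) = ModelFrobenioid.div ψ
    rw [dval_φOf, sdiv_sdiv, φOf_dval]
  · change swapUnit (sdiv (expo (ModelFrobenioid.baseMap ψ)) (ModelFrobenioid.degFr ψ)
      (dval (φOf (op pt) (sdiv (ModelFrobenioid.degFr ψ) (expo (ModelFrobenioid.baseMap ψ))
        (dval (ModelFrobenioid.div ψ)))))) = ModelFrobenioid.unit ψ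
    rw [dval_φOf, sdiv_sdiv, unit_eq_swapUnit]

/-- **The swap is full.** [cite: MochizukiFrdI2008, Thm. 5.2(i) p.100] -/
theorem swap_full : swap.Full := ⟨fun {X Y} ψ => ⟨swapPre X Y ψ, swap_map_swapPre X Y ψ⟩⟩

/-- The pre-step `(1, id, 0, u) : (•, c) → (•, c')` with the rational function of divisor `c/c'`.
[cite: MochizukiFrdI2008, Thm. 5.2(i) p.100] -/
def clsHom (c c' : Algebra.GrothendieckGroup (C.divisorMonoid.obj (op pt) : Type)) :
    (⟨pt, c⟩ : C.category) ⟶ ⟨pt, c'⟩ :=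
  homOf ⟨pt, c⟩ ⟨pt, c'⟩ 1 (𝟙 pt) 1

/-- `clsHom c c' ≫ clsHom c' c = id`. [cite: MochizukiFrdI2008, Thm. 5.2(i) p.100] -/
theorem clsHom_comp (c c' : Algebra.GrothendieckGroup (C.divisorMonoid.obj (op pt) : Type)) :
    clsHom c c' ≫ clsHom c' c = 𝟙 _ := by
  apply ModelFrobenioid.hom_ext
  · rfl
  · change ((1 : ℕ+) * 1 : ℕ+) = 1
    rw [mul_one]
  · change (C.divisorMonoid.map (𝟙 pt).op).hom 1 * 1 ^ (((1 : ℕ+)) : ℕ) = 1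
    rw [map_one, one_pow, mul_one]
  · apply ratFn_ext
    change ((C.ratFnFunctor.map (𝟙 pt).op).hom (unitOf ⟨pt, c'⟩ ⟨pt, c⟩ 1 (𝟙 pt) 1)).1.2 *
        (unitOf ⟨pt, c⟩ ⟨pt, c'⟩ 1 (𝟙 pt) 1 ^ (((1 : ℕ+)) : ℕ)).1.2 = 1
    rw [op_id, C.ratFnFunctor.map_id, CommMonCat.hom_id, MonoidHom.id_apply, PNat.one_coe, pow_one]
    change (pullGp C.divisorMonoid (𝟙 pt) c)⁻¹ * (c' ^ (((1 : ℕ+)) : ℕ) * Algebra.GrothendieckGroup.of 1) *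
        ((pullGp C.divisorMonoid (𝟙 pt) c')⁻¹ * (c ^ (((1 : ℕ+)) : ℕ) * Algebra.GrothendieckGroup.of 1)) = 1
    rw [pullGp_id, pullGp_id, PNat.one_coe, pow_one, pow_one, map_one, mul_one, mul_one]
    exact calc c⁻¹ * c' * (c'⁻¹ * c) = c⁻¹ * (c' * (c'⁻¹ * c)) := mul_assoc _ _ _
      _ = c⁻¹ * c := by rw [mul_inv_cancel_left]
      _ = 1 := inv_mul_cancel c

/-- **All objects of `C` are isomorphic**: `(•, c) ≅ (•, c')`. [cite: MochizukiFrdI2008, Thm. 5.2(i) p.100] -/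
def clsIso (c c' : Algebra.GrothendieckGroup (C.divisorMonoid.obj (op pt) : Type)) :
    (⟨pt, c⟩ : C.category) ≅ ⟨pt, c'⟩ :=
  ⟨clsHom c c', clsHom c' c, clsHom_comp c c', clsHom_comp c' c⟩

/-- **The swap is essentially surjective** (every object is isomorphic to `X₀`). [cite: MochizukiFrdI2008, Thm. 5.2(i) p.100] -/
theorem swap_essSurj : swap.EssSurj := ⟨fun Y => ⟨X₀, ⟨clsIso 1 Y.cls⟩⟩⟩

/-- **The swap is an equivalence of categories** `C ⥲ C`. [cite: MochizukiFrdI2008, Thm. 5.2(i) p.100] -/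
theorem isEquivalence_swap : swap.IsEquivalence :=
  { faithful := swap_faithful, full := swap_full, essSurj := swap_essSurj }

/-- **The degree↔dilation swap as a self-equivalence `Ψ : C ≌ C`** of the category of the typed tempered
Frobenioid `C` (Mathlib's `Functor.asEquivalence`; `Ψ.functor = swap` definitionally).
[cite: MochizukiEtTh2009, Cor 3.8 p.80] -/
def swapEquiv : C.category ≌ C.category :=
  @Functor.asEquivalence _ _ _ _ swap isEquivalence_swap

/-- `swapEquiv.functor = swap`. [cite: MochizukiEtTh2009, Cor 3.8 p.80] -/
theorem swapEquiv_functor : swapEquiv.functor = swap := rfl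

/-! ## §6 Test arrows: isomorphisms of the base, and the linear base-dilation `λ₂` -/

/-- In the base `SingleObj ℕ_{≥1}` an isomorphism has exponent `1`. [cite: MochizukiFrdI2008, §0 p.14] -/
theorem expo_eq_one_of_isIso {A B : SingleObj ℕ+} (f : A ⟶ B) [IsIso f] : expo f = 1 := by
  have h : expo (inv f) * expo f = 1 := congrArg expo (IsIso.hom_inv_id f)
  have h' := congrArg (fun x : ℕ+ => (x : ℕ)) h
  simp only [PNat.mul_coe, PNat.one_coe] at h'
  exact PNat.coe_inj.mp (by rw [PNat.one_coe]; exact Nat.eq_one_of_mul_eq_one_left h')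

/-- An arrow of the base with exponent `1` is an isomorphism. [cite: MochizukiFrdI2008, §0 p.14] -/
theorem isIso_of_expo_eq_one {A B : SingleObj ℕ+} (f : A ⟶ B) (h : expo f = 1) : IsIso f :=
  ⟨⟨arrowAt B A 1, by change (1 : ℕ+) * expo f = 1; rw [h, mul_one], by change expo f * (1 : ℕ+) = 1; rw [h, mul_one]⟩⟩

/-- The LINEAR arrow `λ₂ = (deg 1, base exponent 2, Div 0, ·)` of `X₀` (a base-dilation; not a pre-step).
[cite: MochizukiFrdI2008, Def. 1.2 (i) p.21] -/
def lam₂ : X₀ ⟶ X₀ := homOf X₀ X₀ 1 (arrowAt pt pt 2) 1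

/-- `λ₂` is linear (`deg_Fr = 1`). [cite: MochizukiFrdI2008, Def. 1.2 (i) p.21] -/
theorem isLinear_lam₂ : C.opsData.IsLinear lam₂ := rfl

/-- **The swap sends the linear `λ₂` to an arrow of Frobenius degree `2`** (the Frobenius `(2, id, 0, ·)` of `X₀`).
[cite: MochizukiFrdI2008, Def. 1.2 (i) p.21] -/
theorem degFr_swap_lam₂ : ModelFrobenioid.degFr (swap.map lam₂) = 2 := rfl

end DilSwap

end Literature.AnabelianGeometry.EtaleTheta

end
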